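import Mathlib
import Literature.Computability.AlgebraicComplexity.HessianAtOrigin
import Literature.Computability.AlgebraicComplexity.MignonRessayreBound
import Summits.ValiantsHypothesis.ValiantsHypothesis.Theorems.GrenetZeonTwoDimCoefficientsDefs
import Summits.ValiantsHypothesis.ValiantsHypothesis.Theorems.GrenetZeonTwoDimCoefficientsUnitCase
import Summits.ValiantsHypothesis.ValiantsHypothesis.Theorems.GrenetZeonTwoDimCoefficientsScalingClosureReduction
import Summits.ValiantsHypothesis.ValiantsHypothesis.Theorems.GrenetZeonTwoDimCoefficientsScalingClosureShadow
import Summits.ValiantsHypothesis.ValiantsHypothesis.Theorems.GrenetZeonTwoDimCoefficientsScalingAlgebra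
import Summits.ValiantsHypothesis.ValiantsHypothesis.Theorems.GrenetZeonTwoDimCoefficientsScalingRung

/-!
# Crux `GrenetZeon.TwoDimCoefficients` (stmt-ValiantsHypothesis-8062), stub `stub_dualUnipotent`:
# scaling-closure — the SHADOW FAMILY for arbitrary width, and `n² ≤ 2m` for companion-free representations

`…ScalingRung` built the scaling family only for `m < 2n` (no companions).  Here the family is built for ANY
width `m` under the honest hypothesis that makes it a polynomial — `deg D_k ≤ k·n` for `k ≥ 2`, where
`D_k = [X^k] det(X·B + A)` — and its special fibre is the SHADOW
`Φ = c + β⁻¹·per_n + Σ_{k ≥ 2} [D_k]_{kn}`: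

* `eq_of_eval_eq_off_slice` — two polynomials in `ℂ[z, δ]` that agree off the hyperplane `δ = 0` are equal;
* `sum_homogeneousComponent_range_of_vanishing`, `pow_mul_eval_inv_smul` — truncated homogeneous expansions
  and the dilation identity `δ₀^N·f(z/δ₀) = Σ_{d ≤ N} δ₀^{N−d} f_d(z)`;
* ★ `exists_shadowFamily` — for `det A = c ≠ 0`, `per_n = αc + β·tr(adj A·B)`, `2 ≤ m`, and
  `[D_k]_d = 0` for `d > kn` (`k ≥ 2`): a polynomial `P(z, δ)` with `P(z, 0) = Φ(z)` and the Mignon–Ressayre slice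
  bound `rank Hess_z P ≤ 2m` at every zero off `δ = 0`;
* ★ `rank_hess0_shadow_le_of_dualUnipotent` — hence `rank Hess Φ(z₀) ≤ 2m` at every smooth zero `z₀` of `Φ`
  (✓ `rank_hess0_shadow_le`);
* ★ `sq_le_two_mul_of_companionFree` — if moreover `[D_k]_{kn} = 0` for all `k ≥ 2` (COMPANION-FREE), then
  `n² ≤ 2m` (`n ≥ 3`; ✓ `sq_le_of_scalingFamily`): companion-free unipotent dual representations of the
  permanent obey Mignon–Ressayre's bound.

HONEST FRAMING: instruments + a conditional-on-shape rung; for general representations the companions are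
present (IMM witness of PROFILE-BARRIER has `deg D_k = kn` exactly) and the stub `DualUnipotentBound`, the crux
and `VP ≠ VNP` remain open.

References: T. Mignon, N. Ressayre, Int. Math. Res. Not. 2004:79, Thm. 1.1 (tree `rank_hess0_det_le`).
-/

-- single-conjunct layout `Summits/ValiantsHypothesis/ValiantsHypothesis`: the duplicated namespace
-- component is mandated by the tree.
set_option linter.dupNamespace false
set_option autoImplicit false

noncomputable section

namespace Summit.ValiantsHypothesis.ValiantsHypothesis.Theorems.GrenetZeonTwoDimCoefficients.ScalingClosure

open MvPolynomial Matrix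
open Literature.Computability.AlgebraicComplexity
open Summit.ValiantsHypothesis.ValiantsHypothesis.Cruxes.TwoDimCoefficients.DimTwoCases

/-! ### Generic tools -/

section Tools

variable {σ : Type*} [Fintype σ]

omit [Fintype σ] in
/-- **Two polynomials in `ℂ[z, δ]` agreeing off the hyperplane `δ = 0` are equal** (multiply by `δ` and
use `MvPolynomial.funext`; `ℂ[z, δ]` is a domain). [folklore] -/
theorem eq_of_eval_eq_off_slice (F G : MvPolynomial (Option σ) ℂ)
    (h : ∀ d : ℂ, d ≠ 0 → ∀ z : σ → ℂ,
      eval (fun o : Option σ => o.elim d z) F = eval (fun o : Option σ => o.elim d z) G) :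
    F = G := by
  have hX : (X none : MvPolynomial (Option σ) ℂ) * F = X none * G := by
    apply MvPolynomial.funext
    intro x
    rw [map_mul, map_mul, eval_X]
    by_cases hx : x none = 0
    · rw [hx, zero_mul, zero_mul]
    · have hxe : x = fun o : Option σ => o.elim (x none) (fun s => x (some s)) := by
        funext o
        cases o <;> rfl
      rw [hxe, h (x none) hx]
  exact mul_left_cancel₀ (X_ne_zero none) hX

omit [Fintype σ] in
/-- Truncated homogeneous expansion: if all components above `N` vanish, `f = Σ_{d ≤ N} f_d`. [folklore] -/
theorem sum_homogeneousComponent_range_of_vanishing (f : MvPolynomial σ ℂ) (N : ℕ)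
    (h : ∀ d, N < d → homogeneousComponent d f = 0) :
    ∑ d ∈ Finset.range (N + 1), homogeneousComponent d f = f := by
  have h1 : ∑ d ∈ Finset.range (N + 1), homogeneousComponent d f =
      ∑ d ∈ Finset.range (max N f.totalDegree + 1), homogeneousComponent d f :=
    Finset.sum_subset (Finset.range_mono (by omega)) fun d hd hdn => by
      simp only [Finset.mem_range, not_lt] at hd hdn
      exact h d (by omega)
  have h2 : ∑ d ∈ Finset.range (f.totalDegree + 1), homogeneousComponent d f =
      ∑ d ∈ Finset.range (max N f.totalDegree + 1), homogeneousComponent d f :=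
    Finset.sum_subset (Finset.range_mono (by omega)) fun d hd hdn => by
      simp only [Finset.mem_range, not_lt] at hd hdn
      exact homogeneousComponent_eq_zero _ _ (by omega)
  rw [h1, ← h2, sum_homogeneousComponent]

/-- **Dilation identity.**  If all components of `f` above `N` vanish and `δ₀ ≠ 0`, then
`δ₀^N · f(δ₀⁻¹·z) = Σ_{d ≤ N} δ₀^{N−d}·f_d(z)`. [folklore] -/
theorem pow_mul_eval_inv_smul (f : MvPolynomial σ ℂ) (N : ℕ)
    (h : ∀ d, N < d → homogeneousComponent d f = 0) {d : ℂ} (hd : d ≠ 0) (z : σ → ℂ) :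
    d ^ N * eval (d⁻¹ • z) f =
      ∑ k ∈ Finset.range (N + 1), d ^ (N - k) * eval z (homogeneousComponent k f) := by
  conv_lhs => rw [← sum_homogeneousComponent_range_of_vanishing f N h]
  rw [map_sum, Finset.mul_sum]
  refine Finset.sum_congr rfl fun k hk => ?_
  rw [eval_smul_of_isHomogeneous _ (homogeneousComponent_isHomogeneous k f), ← mul_assoc]
  congr 1
  have hkN : k ≤ N := Nat.lt_succ_iff.mp (Finset.mem_range.mp hk)
  rw [inv_pow, pow_sub₀ _ hd hkN]

end Tools

/-! ### The shadow family -/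

section Shadow

variable {n m : ℕ}

/-- ★ **The shadow family.**  Data: affine `A, B` with `det A = c ≠ 0`,
`per_n = α·c + β·tr(adj A·B)`, `2 ≤ m`, `1 ≤ n`, and the COMPANION-DEGREE hypothesis
`[D_k]_d = 0` for `d > k·n`, `k ≥ 2`, where `D_k = [X^k] det(X·B + A)`.  Then there is
`P ∈ ℂ[z, δ]` whose special fibre is the shadow `Φ(z) = c + β⁻¹·per_n(z) + Σ_{2 ≤ k ≤ m} [D_k]_{kn}(z)`
and whose `z`-Hessian has rank `≤ 2m` at every zero off `δ = 0` (Mignon–Ressayre on the slices).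
[cite: MignonRessayre2004, Thm. 1.1 — via the tree; folklore scaling] -/
theorem exists_shadowFamily (A B : AffMat n m) (hA : IsAffine A) (hB : IsAffine B) (α β c : ℂ)
    (hc : c ≠ 0) (hβ : β ≠ 0) (hdet : A.det = MvPolynomial.C c)
    (hper : perPoly (Fin n) ℂ = MvPolynomial.C α * A.det + MvPolynomial.C β * (A.adjugate * B).trace)
    (hn : 1 ≤ n) (hm2 : 2 ≤ m)
    (D : ℕ → MvPolynomial (Fin n × Fin n) ℂ)
    (hD : ∀ k, D k = (det ((Polynomial.X : Polynomial (MvPolynomial (Fin n × Fin n) ℂ)) •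
      B.map Polynomial.C + A.map Polynomial.C)).coeff k)
    (hdeg : ∀ k, 2 ≤ k → ∀ d, k * n < d → homogeneousComponent d (D k) = 0) :
    ∃ P : MvPolynomial (Option (Fin n × Fin n)) ℂ,
      (∀ z : Fin n × Fin n → ℂ, eval (fun o : Option (Fin n × Fin n) => o.elim (0 : ℂ) z) P =
        eval z (MvPolynomial.C c + MvPolynomial.C β⁻¹ * perPoly (Fin n) ℂ +
          ∑ k ∈ Finset.range (m + 1), if 2 ≤ k then homogeneousComponent (k * n) (D k) else 0)) ∧
      (∀ x : Option (Fin n × Fin n) → ℂ, x none ≠ 0 → eval x P = 0 →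
        ((Matrix.of fun s t : Fin n × Fin n => pderiv (some s) (pderiv (some t) P)).map
          (eval x)).rank ≤ 2 * m) := by
  classical
  -- homogenised matrices and the coefficient polynomials `E_k`
  set Ah : Matrix (Fin m) (Fin m) (MvPolynomial (Option (Fin n × Fin n)) ℂ) :=
    Matrix.of fun i j => rename some (homogeneousComponent 1 (A i j)) +
      MvPolynomial.C (coeff 0 (A i j)) * X none with hAh_def
  set Bh : Matrix (Fin m) (Fin m) (MvPolynomial (Option (Fin n × Fin n)) ℂ) :=
    Matrix.of fun i j => rename some (homogeneousComponent 1 (B i j)) +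
      MvPolynomial.C (coeff 0 (B i j)) * X none with hBh_def
  have hAh : ∀ i j, Ah i j = rename some (homogeneousComponent 1 (A i j)) +
      MvPolynomial.C (coeff 0 (A i j)) * X none := fun i j => rfl
  have hBh : ∀ i j, Bh i j = rename some (homogeneousComponent 1 (B i j)) +
      MvPolynomial.C (coeff 0 (B i j)) * X none := fun i j => rfl
  set E : ℕ → MvPolynomial (Option (Fin n × Fin n)) ℂ := fun k =>
    (det ((Polynomial.X : Polynomial (MvPolynomial (Option (Fin n × Fin n)) ℂ)) •
      Bh.map Polynomial.C + Ah.map Polynomial.C)).coeff k with hE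
  -- the tail polynomials `Q_k = Σ_{d ≤ kn} δ^{kn-d}·[D_k]_d` and the family
  set Q : ℕ → MvPolynomial (Option (Fin n × Fin n)) ℂ := fun k =>
    ∑ d ∈ Finset.range (k * n + 1), (X none) ^ (k * n - d) *
      rename some (homogeneousComponent d (D k)) with hQ
  set P : MvPolynomial (Option (Fin n × Fin n)) ℂ :=
    MvPolynomial.C c + MvPolynomial.C β⁻¹ * rename some (perPoly (Fin n) ℂ) -
      MvPolynomial.C (α * c * β⁻¹) * (X none) ^ n +
      ∑ k ∈ Finset.range (m + 1), if 2 ≤ k then Q k else 0 with hP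
  set M : Matrix (Fin m) (Fin m) (MvPolynomial (Option (Fin n × Fin n)) ℂ) :=
    (X none : MvPolynomial (Option (Fin n × Fin n)) ℂ) ^ n • Bh + Ah with hM
  -- values of `D_0`, `D_1`
  have hu : IsUnit A.det := by
    rw [hdet]
    exact (isUnit_iff_ne_zero.mpr hc).map MvPolynomial.C
  have hD0 : ∀ w : Fin n × Fin n → ℂ, eval w (D 0) = c := fun w => by
    rw [hD, coeff_det_zero, hdet, MvPolynomial.eval_C]
  have hD1 : ∀ w : Fin n × Fin n → ℂ,
      β * eval w (D 1) = eval w (perPoly (Fin n) ℂ) - α * c := fun w => by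
    rw [hD, coeff_det_one A B hu]
    have h := congrArg (eval w) hper
    rw [map_add, map_mul, map_mul, MvPolynomial.eval_C, MvPolynomial.eval_C, hdet,
      MvPolynomial.eval_C] at h
    linear_combination -h
  -- the polynomial identity `det M = δ^m · P`, proved off `δ = 0`
  have hdetM : M.det = (X none) ^ m * P := by
    apply eq_of_eval_eq_off_slice
    intro d hd z
    set x : Option (Fin n × Fin n) → ℂ := fun o => o.elim d z with hx
    have hXn : eval x (X none : MvPolynomial (Option (Fin n × Fin n)) ℂ) = d := by
      simp only [MvPolynomial.eval_X, hx, Option.elim]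
    have hEk : ∀ k, eval x (E k) = d ^ m * eval (d⁻¹ • z) (D k) := fun k => by
      rw [hD]
      exact eval_coeff_det_homog A B hA hB Ah Bh hAh hBh hd z k
    have hper' : eval x (rename some (perPoly (Fin n) ℂ)) = eval z (perPoly (Fin n) ℂ) := by
      rw [MvPolynomial.eval_rename]
      rfl
    have hQk : ∀ k, 2 ≤ k → eval x (Q k) = d ^ (k * n) * eval (d⁻¹ • z) (D k) := by
      intro k hk
      rw [pow_mul_eval_inv_smul (D k) (k * n) (hdeg k hk) hd z, hQ]
      simp only [map_sum, map_mul, map_pow, hXn, MvPolynomial.eval_rename]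
      rfl
    -- expand `det M`
    have hL : eval x M.det = ∑ k ∈ Finset.range (m + 1), eval x (E k) * (d ^ n) ^ k := by
      have h := congrArg (eval x) (det_smul_add_eq_sum_coeff
        ((X none : MvPolynomial (Option (Fin n × Fin n)) ℂ) ^ n) Ah Bh)
      rw [Fintype.card_fin, map_sum] at h
      rw [hM, h]
      refine Finset.sum_congr rfl fun k _ => ?_
      rw [map_mul, map_pow, map_pow, hXn]
    obtain ⟨m', rfl⟩ : ∃ m', m = m' + 2 := ⟨m - 2, by omega⟩
    have hL' : ∑ k ∈ Finset.range (m' + 2 + 1), eval x (E k) * (d ^ n) ^ k =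
        eval x (E 0) + eval x (E 1) * d ^ n +
          ∑ k ∈ Finset.range (m' + 1), eval x (E (k + 1 + 1)) * (d ^ n) ^ (k + 1 + 1) := by
      rw [Finset.sum_range_succ', Finset.sum_range_succ']
      ring
    have h20 : ¬ (2 ≤ 0) := by omega
    have h21 : ¬ (2 ≤ 0 + 1) := by omega
    have hR : ∑ k ∈ Finset.range (m' + 2 + 1), eval x (if 2 ≤ k then Q k else 0) =
        ∑ k ∈ Finset.range (m' + 1), d ^ ((k + 1 + 1) * n) * eval (d⁻¹ • z) (D (k + 1 + 1)) := by
      rw [Finset.sum_range_succ', Finset.sum_range_succ']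
      simp only [h20, h21, if_false, map_zero, add_zero]
      refine Finset.sum_congr rfl fun k _ => ?_
      rw [if_pos (by omega), hQk _ (by omega)]
    have htail : ∑ k ∈ Finset.range (m' + 1), eval x (E (k + 1 + 1)) * (d ^ n) ^ (k + 1 + 1) =
        d ^ (m' + 2) * ∑ k ∈ Finset.range (m' + 1),
          d ^ ((k + 1 + 1) * n) * eval (d⁻¹ • z) (D (k + 1 + 1)) := by
      rw [Finset.mul_sum]
      refine Finset.sum_congr rfl fun k _ => ?_
      rw [hEk, ← pow_mul, mul_comm n]
      ring
    rw [map_mul, map_pow, hXn, hL, hL', map_add, map_sub, map_add, map_mul, map_mul,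
      MvPolynomial.eval_C, MvPolynomial.eval_C, MvPolynomial.eval_C, map_pow, hXn, map_sum, hper', hR,
      htail, hEk 0, hEk 1, hD0]
    have hdn : d⁻¹ ^ n * d ^ n = 1 := by rw [← mul_pow, inv_mul_cancel₀ hd, one_pow]
    have hβi : β * β⁻¹ = 1 := mul_inv_cancel₀ hβ
    have h1 := hD1 (d⁻¹ • z)
    rw [eval_smul_perPoly] at h1
    linear_combination (β⁻¹ * d ^ (m' + 2) * d ^ n) * h1 -
      (d ^ (m' + 2) * d ^ n * eval (d⁻¹ • z) (D 1)) * hβi +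
      (β⁻¹ * d ^ (m' + 2) * eval z (perPoly (Fin n) ℂ)) * hdn
  refine ⟨P, ?_, ?_⟩
  · -- the special fibre is the shadow
    intro z
    have hcomp : ((fun o : Option (Fin n × Fin n) => o.elim (0 : ℂ) z) ∘ some) = z :=
      funext fun _ => rfl
    have hQ0 : ∀ k, eval (fun o : Option (Fin n × Fin n) => o.elim (0 : ℂ) z) (Q k) =
        eval z (homogeneousComponent (k * n) (D k)) := by
      intro k
      rw [hQ]
      simp only [map_sum, map_mul, map_pow, MvPolynomial.eval_X, MvPolynomial.eval_rename, hcomp,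
        Option.elim_none]
      rw [Finset.sum_eq_single (k * n)]
      · rw [Nat.sub_self, pow_zero, one_mul]
      · intro d hd hne
        have hlt : d < k * n := lt_of_le_of_ne (Nat.lt_succ_iff.mp (Finset.mem_range.mp hd)) hne
        rw [zero_pow (by omega : k * n - d ≠ 0), zero_mul]
      · intro h
        exact absurd (Finset.mem_range.mpr (Nat.lt_succ_self _)) h
    have hS : eval (fun o : Option (Fin n × Fin n) => o.elim (0 : ℂ) z)
        (∑ k ∈ Finset.range (m + 1), if 2 ≤ k then Q k else 0) =
        eval z (∑ k ∈ Finset.range (m + 1),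
          if 2 ≤ k then homogeneousComponent (k * n) (D k) else 0) := by
      rw [map_sum, map_sum]
      refine Finset.sum_congr rfl fun k _ => ?_
      split_ifs with hk
      · exact hQ0 k
      · rw [map_zero, map_zero]
    rw [hP]
    simp only [map_add, map_sub, map_mul, map_pow, MvPolynomial.eval_C, MvPolynomial.eval_X,
      MvPolynomial.eval_rename, hcomp, Option.elim_none, hS, zero_pow (by omega : n ≠ 0), mul_zero,
      sub_zero]
  · -- Mignon–Ressayre on the slices `δ = δ₀ ≠ 0`
    intro x hx0 hxP
    set d : ℂ := x none with hd
    set z : Fin n × Fin n → ℂ := fun s => x (some s) with hz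
    have hx : x = fun o : Option (Fin n × Fin n) => o.elim d z := by
      funext o
      cases o <;> rfl
    set g : Option (Fin n × Fin n) → MvPolynomial (Fin n × Fin n) ℂ :=
      fun o => o.elim (MvPolynomial.C d) X with hg
    set Pd : MvPolynomial (Fin n × Fin n) ℂ := aeval g P with hPd
    have hslice : ∀ z' : Fin n × Fin n → ℂ,
        eval (fun o : Option (Fin n × Fin n) => o.elim d z') P = eval z' Pd :=
      fun z' => (eval_aeval_slice P d z').symm
    have hHx : (Matrix.of fun s t : Fin n × Fin n => pderiv (some s) (pderiv (some t) P)).map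
        (eval x) = hess0 (transl z Pd) := by
      rw [hx]
      exact hessian_slice P Pd d hslice z
    set Md : Matrix (Fin m) (Fin m) (MvPolynomial (Fin n × Fin n) ℂ) := M.map (aeval g) with hMd
    have hgX : aeval g (X none : MvPolynomial (Option (Fin n × Fin n)) ℂ) = MvPolynomial.C d := by
      rw [MvPolynomial.aeval_X, hg]
      rfl
    have hMd_aff : ∀ i j, (Md i j).totalDegree ≤ 1 := by
      intro i j
      rw [hMd, hM, Matrix.map_apply, Matrix.add_apply, Matrix.smul_apply, map_add, smul_eq_mul,
        map_mul, map_pow, hgX, ← map_pow]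
      refine (totalDegree_add _ _).trans (max_le ?_ ?_)
      · refine (totalDegree_mul _ _).trans ?_
        rw [totalDegree_C, zero_add]
        exact totalDegree_aeval_homog_le d
      · exact totalDegree_aeval_homog_le d
    have hdetMd : Md.det = MvPolynomial.C (d ^ m) * Pd := by
      rw [hMd, ← AlgHom.mapMatrix_apply, ← AlgHom.map_det, hdetM, map_mul, map_pow, hgX, ← map_pow]
    set A' : Matrix (Fin m) (Fin m) (MvPolynomial (Fin n × Fin n) ℂ) :=
      (transl z).mapMatrix Md with hA'
    have hA'aff : ∀ i j, (A' i j).totalDegree ≤ 1 := fun i j => by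
      rw [hA', AlgHom.mapMatrix_apply, Matrix.map_apply]
      exact (totalDegree_transl_le _ _).trans (hMd_aff i j)
    have hA'det : A'.det = MvPolynomial.C (d ^ m) * transl z Pd := by
      rw [hA', ← AlgHom.map_det, hdetMd, map_mul, transl_C]
    have hcc : constantCoeff A'.det = 0 := by
      rw [hA'det, map_mul, constantCoeff_C, constantCoeff_transl, ← hslice z, ← hx, hxP, mul_zero]
    have hr := rank_hess0_det_le A' hA'aff hcc
    rw [hA'det, hess0_C_mul, rank_smul_eq (pow_ne_zero _ hx0)] at hr
    rw [hHx]
    exact hr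

/-- ★ **Mignon–Ressayre for the shadow of a unipotent dual representation.**  Under the hypotheses of
`exists_shadowFamily`, at every zero `z₀` of the shadow
`Φ = c + β⁻¹·per_n + Σ_{2 ≤ k ≤ m} [D_k]_{kn}` with some `∂_i Φ(z₀) ≠ 0`: `rank Hess Φ(z₀) ≤ 2m`.
[cite: MignonRessayre2004, Thm. 1.1 — via the tree; folklore] -/
theorem rank_hess0_shadow_le_of_dualUnipotent (A B : AffMat n m) (hA : IsAffine A) (hB : IsAffine B)
    (α β c : ℂ) (hc : c ≠ 0) (hβ : β ≠ 0) (hdet : A.det = MvPolynomial.C c)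
    (hper : perPoly (Fin n) ℂ = MvPolynomial.C α * A.det + MvPolynomial.C β * (A.adjugate * B).trace)
    (hn : 1 ≤ n) (hm2 : 2 ≤ m)
    (D : ℕ → MvPolynomial (Fin n × Fin n) ℂ)
    (hD : ∀ k, D k = (det ((Polynomial.X : Polynomial (MvPolynomial (Fin n × Fin n) ℂ)) •
      B.map Polynomial.C + A.map Polynomial.C)).coeff k)
    (hdeg : ∀ k, 2 ≤ k → ∀ d, k * n < d → homogeneousComponent d (D k) = 0)
    (z₀ : Fin n × Fin n → ℂ)
    (hz : eval z₀ (MvPolynomial.C c + MvPolynomial.C β⁻¹ * perPoly (Fin n) ℂ +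
      ∑ k ∈ Finset.range (m + 1), if 2 ≤ k then homogeneousComponent (k * n) (D k) else 0) = 0)
    (i : Fin n × Fin n)
    (hi : eval z₀ (pderiv i (MvPolynomial.C c + MvPolynomial.C β⁻¹ * perPoly (Fin n) ℂ +
      ∑ k ∈ Finset.range (m + 1), if 2 ≤ k then homogeneousComponent (k * n) (D k) else 0)) ≠ 0) :
    (hess0 (transl z₀ (MvPolynomial.C c + MvPolynomial.C β⁻¹ * perPoly (Fin n) ℂ +
      ∑ k ∈ Finset.range (m + 1), if 2 ≤ k then homogeneousComponent (k * n) (D k) else 0))).rank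
      ≤ 2 * m := by
  classical
  obtain ⟨P, h0, hMR⟩ := exists_shadowFamily A B hA hB α β c hc hβ hdet hper hn hm2 D hD hdeg
  exact rank_hess0_shadow_le P _ (2 * m) h0 hMR z₀ hz i hi

/-- ★ **Companion-free unipotent dual representations obey Mignon–Ressayre: `n² ≤ 2m`.**  If
`det A = c ≠ 0`, `per_n = α·c + β·tr(adj A·B)` (`n ≥ 3`, `m ≥ 2`) and the companions vanish —
`[D_k]_d = 0` for all `d ≥ k·n`, `k ≥ 2`, `D_k = [X^k] det(X·B + A)` — then `n² ≤ 2m`.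
(The special fibre is then `c + β⁻¹·per_n`; ✓ `sq_le_of_scalingFamily`.)
[cite: MignonRessayre2004, Thm. 1.1 — via the tree; folklore] -/
theorem sq_le_two_mul_of_companionFree {k m : ℕ} (A B : AffMat (k + 3) m) (hA : IsAffine A)
    (hB : IsAffine B) (α β c : ℂ) (hc : c ≠ 0) (hβ : β ≠ 0) (hdet : A.det = MvPolynomial.C c)
    (hper : perPoly (Fin (k + 3)) ℂ =
      MvPolynomial.C α * A.det + MvPolynomial.C β * (A.adjugate * B).trace)
    (hm2 : 2 ≤ m) (D : ℕ → MvPolynomial (Fin (k + 3) × Fin (k + 3)) ℂ)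
    (hD : ∀ j, D j = (det ((Polynomial.X : Polynomial (MvPolynomial (Fin (k + 3) × Fin (k + 3)) ℂ)) •
      B.map Polynomial.C + A.map Polynomial.C)).coeff j)
    (hfree : ∀ j, 2 ≤ j → ∀ d, j * (k + 3) ≤ d → homogeneousComponent d (D j) = 0) :
    (k + 3) ^ 2 ≤ 2 * m := by
  classical
  obtain ⟨P, h0, hMR⟩ := exists_shadowFamily A B hA hB α β c hc hβ hdet hper (by omega) hm2 D hD
    (fun j hj d hd => hfree j hj d hd.le)
  have hsum : (∑ j ∈ Finset.range (m + 1),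
      if 2 ≤ j then homogeneousComponent (j * (k + 3)) (D j) else 0) = 0 := by
    refine Finset.sum_eq_zero fun j _ => ?_
    split_ifs with hj
    · exact hfree j hj _ le_rfl
    · rfl
  have h0' : ∀ z : Fin (k + 3) × Fin (k + 3) → ℂ,
      eval (fun o : Option (Fin (k + 3) × Fin (k + 3)) => o.elim (0 : ℂ) z) P =
        c + β⁻¹ * eval z (perPoly (Fin (k + 3)) ℂ) := by
    intro z
    rw [h0 z, hsum, add_zero, map_add, map_mul, MvPolynomial.eval_C, MvPolynomial.eval_C]
  have h0'' : ∀ z : Fin (k + 3) × Fin (k + 3) → ℂ,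
      eval (fun o : Option (Fin (k + 3) × Fin (k + 3)) => o.elim (0 : ℂ) z) P =
        eval z (MvPolynomial.C c + MvPolynomial.C β⁻¹ * perPoly (Fin (k + 3)) ℂ) := by
    intro z
    rw [h0' z, map_add, map_mul, MvPolynomial.eval_C, MvPolynomial.eval_C]
  have hH0 : ∀ z : Fin (k + 3) × Fin (k + 3) → ℂ,
      (hess0 (transl z (perPoly (Fin (k + 3)) ℂ))).rank ≤
        ((Matrix.of fun s t : Fin (k + 3) × Fin (k + 3) => pderiv (some s) (pderiv (some t) P)).map
          (eval (fun o : Option (Fin (k + 3) × Fin (k + 3)) => o.elim (0 : ℂ) z))).rank := by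
    intro z
    have hT : hess0 (transl z (MvPolynomial.C c + MvPolynomial.C β⁻¹ * perPoly (Fin (k + 3)) ℂ)) =
        β⁻¹ • hess0 (transl z (perPoly (Fin (k + 3)) ℂ)) := by
      rw [map_add, map_mul, transl_C, transl_C, map_add, hess0_C_mul,
        hess0_eq_zero_of_totalDegree_le_one ((totalDegree_C c).le.trans zero_le_one), zero_add]
    rw [hessian_slice P _ 0 h0'' z, hT, rank_smul_eq (inv_ne_zero hβ)]
  exact sq_le_of_scalingFamily (r := 2 * m) P _ c β⁻¹ hc (inv_ne_zero hβ) h0' hH0 hMR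

end Shadow

end Summit.ValiantsHypothesis.ValiantsHypothesis.Theorems.GrenetZeonTwoDimCoefficients.ScalingClosure

end
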